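import Summits.BirchSwinnertonDyer.Rank1Residual.Supersingular.KobayashiMainConjecture
import Summits.BirchSwinnertonDyer.Rank1Residual.Supersingular.SignedSqueezeX7
import Literature.NumberTheory.EllipticCurves.Kobayashi2003.SignedKatoDivisibility
import Literature.NumberTheory.EllipticCurves.Kobayashi2003.SignedSelmerRankBoundProofs
import Literature.NumberTheory.EllipticCurves.Rank1Residual.PeriodUnitProofs
import Literature.NumberTheory.EllipticCurves.Rank1Residual.Typed.X7
import HarnessLib

/-!
# Kobayashi's signed main conjecture AT A RANK-ONE PAIR on the REAL objects, from published
# one-sided inputs and ONE two-engine certificate `(μ, λ)(L_p^ε) = (0, 1)` — classes X7 / X6, `a_p = 0`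
# (cell `b2b-bsdres`, supersingular family, prover B = unit `b2b-bsdres-additive-p3`, gen 3; X7 joint)

HONEST FRAMING (run/shared/lean/b2b/bsd-rank1-residual/, verbatim in every file): the goal of the
cell is to DELETE the COMBINATION-SHAPED residual classes of the Birch–Swinnerton-Dyer formula for
ALL analytic-rank `≤ 1` elliptic curves over `ℚ` — "full BSD formula for every rank `≤ 1` curve in
class `C`" assembled STRICTLY from published theorems — so that the rank-`≤ 1` remainder becomes
exactly the CONSTRUCTION-SHAPED classes, which are TYPED (missing-input `Prop`s), NOT attempted.
This is not "finishing BSD". THEOREMS ONLY (no definition, no named fact, nothing about any curve is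
asserted); X6 / X7 stay CONSTRUCTION-SHAPED; nothing booked. PER PAIR (a certificate binder), NOT a
class theorem.

## What this file does

Gen 2 landed the rank-one λ-SQUEEZE on an abstract datum (`Supersingular/SignedSqueeze.lean`,
p208039; X7/X6 readings `SignedSqueezeX7.lean`, p208539): Kato's divisibility `ξ ∣ L`, control
`T^{rank E(ℚ)} ∣ ξ`, GZK and the two-engine certificate `μ(L) = 0, λ(L) = 1` force `(ξ) = (L)`.
Since then every `±` input became a tree object or a named PUBLISHED fact (harvest-2: Kobayashi's
`Sel^ε(E/ℚ_∞)` and its dual `SignedSelmerDualData` p207367/p207616/p207761, Thm. 1.2 = A94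
`Kobayashi2003.thm12_signedSelmerDual_finite_torsion` p208294, Thm. 4.1 = A98
`Kobayashi2003.thm41_signedCharIdeal_divisibility` p209183, (C) `X_pow_mordellWeilRank_dvd_of_charIdeal_eq_span`
p209483 — a THEOREM —, Pollack's `L^±` and `IsSignedPAdicLFunction`; x10b: `IsPollackPair`,
`kobayashiL`, the cell's TYPED INPUT `KobayashiMainConjecture W p ε` in the Néron normalisation,
p209365; the period-ratio unit = the two named facts `realPeriodRat_eq_unit_mul_plusPeriod(_three)`,
`PeriodUnitProofs`). This file re-targets the squeeze to them:

* `IsPollackPair.isSignedPAdicLFunction_kobayashiL` — Kobayashi's `L_p^ε` picked out of a Pollack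
  pair satisfies harvest-2's `IsSignedPAdicLFunction f p ε` (labelling dictionary, Kobayashi p. 7);
* `kobayashiMainConjecture_of_lam_eq_one_of_analyticRank_eq_one` — **the cell's typed input
  `KobayashiMainConjecture W p ε` HOLDS at a pair** with: `p` odd good, `a_p = 0`, `ρ̄_{E,p}` onto,
  `r_an = 1`, granted the PUBLISHED facts BY NAME — A94 (torsion), A98 (Kato-side divisibility,
  integral under `p`-ADIC surjectivity, which follows from mod-`p` surjectivity at a good odd `p`:
  Serre for `p ≥ 5`, Wuthrich 2014 Lemma 20 at `p = 3`, gen-2 `surjective_pow_of_surj_of_good`),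
  the period-unit facts (`h5`, `h3`: `ord_p(Ω⁺_f/Ω_E) = 0` at an irreducible odd good `p`), GZK
  (`rank E(ℚ) = 1`) — the tree THEOREM (C) `T ∣ ξ^ε`, and ONE displayed per-pair certificate
  `hcert`: "`μ(L_p^ε) = 0` and `λ(L_p^ε) = 1` for Pollack's `L_p^ε` of the newform of `E`"
  (two-engine datum of the census seat iw-2, `tables/ss_support_X678.tsv`; nothing asserted). Proof:
  for every `(κ, γ, f, ϖ, (L⁺,L⁻), D)` of the conjecture's quantifier: `Char(X^ε) = (ξ)` is
  principal (`charIdeal_isPrincipal_holds`), `ξ ∣ L^ε` (A98), `T ∣ ξ` ((C) + GZK), squeeze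
  `(ξ) = (L^ε)` (`span_eq_span_of_dvd_of_X_dvd_of_lam_eq_one`, p208039), and `g := ϖ·L^ε`
  generates the same ideal because `ϖ ∈ ℤ_p^×` — so `Char(X^ε) = (g)`, `ι g = ϖ·ι L^ε`: the
  conjecture's conclusion VERBATIM;
* `X7.kobayashiMainConjecture_of_lam_eq_one_of_analyticRank_eq_one`,
  `X6.kobayashiMainConjecture_of_lam_eq_one_of_analyticRank_eq_one` — class readings (X6: `a_p = 0`
  and surjectivity automatic, `ClassX6.frobeniusTrace_eq_zero` / `ClassX6.surj`; X7: `surj` and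
  `a_p = 0` displayed — automatic for `p ≥ 5`, a hypothesis at `p = 3`).

READING (census of gen 2, X8-ROUTE-B §6(f); harvest-1 g19 `x7r1_table.tsv`): 31 of the 72 X7 ∩
{r_an = 1} pairs `N < 2·10⁴` have `min(λ⁺, λ⁻) = 1` with `μ = 0` on two engines (17 at `p ≥ 5`, 13
at `p = 3` with surj(3), 1 non-surjective excluded) — at each of them the cell's OWN typed input
`KobayashiMainConjecture W p ε` (for that `ε`) is discharged modulo the binders above; what then
separates such a pair from `BSD(E,p)` is the rank-one link "signed IMC ⇒ `p`-part of BSD in rank 1"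
(Kobayashi, Invent. Math. 191 (2013) Cor. 1.3 / 1.4 — primary unread, flag `KOB13-primary-unread`;
not typed here). Nothing is booked; X7 / X6 labels unchanged.

References: [Kobayashi2003] Def. 1.1, Thm. 1.2, Thm. 4.1, (3.4)–(3.6), Thm. 9.3; [Pollack2003]
Prop. 6.18; [GreenbergVatsal2000] p. 4 and §3 Remark 3.4; [Wuthrich2014] Lemma 20; [Serre1972]
Props. 12, 21; [SerreAbelianLadic1968] IV §3.4; [AbbesUllmo1996] Thm. A; [Mazur1978] Cor. 4.1.
Memo: `HOME/b2b-bsdres-additive-p3/X8-ROUTE-B.md` §8 (gen 3).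
-/

set_option autoImplicit false

noncomputable section

open scoped Classical MatrixGroups ModularForm

open CongruenceSubgroup WeierstrassCurve Literature.NumberTheory.EllipticCurves
  Literature.NumberTheory.EllipticCurves.ModularForms
  Literature.NumberTheory.EllipticCurves.Rank1Residual
  Literature.NumberTheory.EllipticCurves.Rank1Residual.Typed
  Literature.NumberTheory.EllipticCurves.Kobayashi2003 ZpExtension
  Summit.BirchSwinnertonDyer.Rank1Residual.X1.MuLambda

namespace Summit.BirchSwinnertonDyer.Rank1Residual.Supersingular

/-! ### Kobayashi's labelling: a Pollack pair supplies `IsSignedPAdicLFunction` -/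

section Labelling

variable {N : ℕ} {f : CuspForm (Gamma0 N) 2} {p : ℕ} [Fact p.Prime]

/-- **Kobayashi's `L_p^ε` picked out of a Pollack pair IS harvest-2's `IsSignedPAdicLFunction f p ε`**:
`ε = 1` ↦ the tree's `L⁻` (even-level congruences), `ε = −1` ↦ the tree's `L⁺` (odd levels) —
Kobayashi, Invent. Math. 152 (2003) p. 7 "our sign of Pollack's `p`-adic `L`-function is opposite to
that in [18]", (3.4)–(3.6). [cite: Kobayashi2003, Thm. 3.2 and (3.4)–(3.6) (p. 7)] [cite: Pollack2003, Prop. 6.18] -/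
theorem IsPollackPair.isSignedPAdicLFunction_kobayashiL {Lplus Lminus : IwasawaAlgebra p}
    (hL : IsPollackPair f p Lplus Lminus) (ε : ℤˣ) :
    IsSignedPAdicLFunction f p ε (kobayashiL ε Lplus Lminus) := by
  rcases Int.units_eq_one_or ε with rfl | rfl
  · rw [kobayashiL, if_pos rfl, isSignedPAdicLFunction_one_iff]
    exact hL.2.2.2
  · have h1 : ((-1 : ℤˣ) = 1) ↔ False := by decide
    rw [kobayashiL, if_neg (h1.mp), isSignedPAdicLFunction_neg_one_iff]
    exact hL.2.2.1

end Labelling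

/-! ### A rational `p`-adic unit as a unit of `ℤ_p` -/

section PeriodUnit

variable {p : ℕ} [Fact p.Prime]

/-- A non-zero rational `ϖ` with `ord_p ϖ = 0` is (the image of) a unit of `ℤ_p`. [folklore] -/
theorem exists_units_coe_eq_ratCast {ϖ : ℚ} (hϖ0 : ϖ ≠ 0) (hv : padicValRat p ϖ = 0) :
    ∃ u : ℤ_[p]ˣ, ((u : ℤ_[p]) : ℚ_[p]) = (ϖ : ℚ_[p]) := by
  have hne : ((ϖ : ℚ) : ℚ_[p]) ≠ 0 := by exact_mod_cast hϖ0
  have hnorm : ‖((ϖ : ℚ) : ℚ_[p])‖ = 1 := by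
    rw [Padic.norm_eq_zpow_neg_valuation hne, Padic.valuation_ratCast, hv, neg_zero, zpow_zero]
  exact ⟨PadicInt.mkUnits hnorm, PadicInt.mkUnits_eq hnorm⟩

/-- Rescaling by a unit constant does not change a principal ideal of `Λ`, and commutes with
`ι : Λ → ℚ_p⟦T⟧` as multiplication by `C u`. [folklore] -/
theorem span_C_units_mul_eq (u : ℤ_[p]ˣ) (L : IwasawaAlgebra p) :
    Ideal.span ({PowerSeries.C (u : ℤ_[p]) * L} : Set (IwasawaAlgebra p)) = Ideal.span {L} ∧
      iwasawaToPowerSeries p (PowerSeries.C (u : ℤ_[p]) * L) =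
        PowerSeries.C ((u : ℤ_[p]) : ℚ_[p]) * iwasawaToPowerSeries p L := by
  refine ⟨Ideal.span_singleton_mul_left_unit ((Units.isUnit u).map PowerSeries.C) L, ?_⟩
  rw [map_mul]
  congr 1
  rw [iwasawaToPowerSeries, PowerSeries.map_C]
  rfl

end PeriodUnit

/-! ### The signed main conjecture at a rank-one pair, on the real objects -/

section Squeeze

variable (W : WeierstrassCurve ℚ) [W.IsElliptic] [W.IsGloballyMinimal] (p : ℕ) [Fact p.Prime]

/-- **Kobayashi's main conjecture for `(E, p, ε)` AT A RANK-ONE PAIR, on the real objects, from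
published one-sided inputs + ONE certificate.** Let `p` be an odd prime of good reduction of `E = W`
with `a_p = 0` and `ρ̄_{E,p}` surjective, and `ord_{s=1} L(E,s) = 1`. Granted, BY NAME: Kobayashi
2003 Thm. 1.2 (`h12`, A94: `X^ε` f.g. torsion), Thm. 4.1 (`h41`, A98: `L_p^ε ∈ Char(X^ε)` under
`p`-adic surjectivity — itself from mod-`p` surjectivity at a good odd `p`: Serre for `p ≥ 5` /
Wuthrich 2014 Lemma 20 (`hL20`) at `p = 3`), the period-unit facts (`h5`, `h3`:
`ord_p(Ω⁺_f/Ω_E) = 0`; Greenberg–Vatsal §3 + Manin constant), GZK (`hGZK`: `rank E(ℚ) = 1`), and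
the per-pair CERTIFICATE `hcert` — "`μ(L) = 0 ∧ λ(L) = 1` for every `L` which is Pollack's `L_p^ε`
of a newform of `E`" (two engines of the census seat; by uniqueness of `L_p^ε` a statement about ONE
power series) —: `KobayashiMainConjecture W p ε`, i.e. for every admissible `(κ, γ, f, ϖ, (L⁺,L⁻), D)`,
`X^ε` is torsion and `Char(X^ε) = (g)` with `ι g = ϖ · ι L^ε`. Squeeze: `ξ ∣ L^ε` (A98), `T ∣ ξ`
((C), tree theorem, + GZK), `μ(L^ε) = 0`, `λ(L^ε) = 1` ⇒ `(ξ) = (L^ε)`; then `g := ϖ L^ε`, `ϖ ∈ ℤ_p^×`.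
PER PAIR; NOT a class theorem; nothing asserted beyond the binders.
[cite: Kobayashi2003, Thm. 1.2 (p. 2), Thm. 4.1 (p. 8) and Conjecture (p. 2)] [cite: GreenbergVatsal2000, p. 4 and §3 Remark 3.4]
[cite: Wuthrich2014, Lemma 20 (p. 399)] [cite: SerreAbelianLadic1968, Ch. IV §3.4] -/
theorem kobayashiMainConjecture_of_lam_eq_one_of_analyticRank_eq_one
    (h12 : Kobayashi2003.thm12_signedSelmerDual_finite_torsion)
    (h41 : Kobayashi2003.thm41_signedCharIdeal_divisibility)
    (h5 : realPeriodRat_eq_unit_mul_plusPeriod) (h3 : realPeriodRat_eq_unit_mul_plusPeriod_three)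
    (hL20 : Wuthrich2014.lemma20_surjective_threeAdic_of_semistable)
    (hGZK : rank_eq_analyticRank_of_analyticRank_le_one)
    (hp : p ≠ 2) (hgood : W.HasGoodReductionAtPrime p) (hap : W.frobeniusTrace p = 0)
    (hs : Surj W p) (h1 : W.analyticRank = 1) (ε : ℤˣ)
    (hcert : ∀ {N : ℕ} [NeZero N] (f : CuspForm (Gamma0 N) 2), IsNewformOf W f →
      ∀ L : IwasawaAlgebra p, IsSignedPAdicLFunction f p ε L → mu L = 0 ∧ lam L = 1) :
    KobayashiMainConjecture W p ε := by
  intro κ γ hκ hγ hγ' _ f hf ϖ hϖ Lplus Lminus hPP D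
  -- Thm. 1.2: `X^ε` finitely generated and torsion
  haveI : Module.Finite (IwasawaAlgebra p) D.X := h12.moduleFinite hp hgood hap hκ hγ D
  have hX : Module.IsTorsion (IwasawaAlgebra p) D.X := h12.isTorsion hp hgood hap hκ hγ D
  refine ⟨hX, ?_⟩
  -- a generator `ξ` of `Char(X^ε)` (principal: `Λ` is a UFD)
  obtain ⟨ξ, hξ⟩ := (charIdeal_isPrincipal_holds p D.X).principal
  have hξ' : D.charIdeal = Ideal.span {ξ} := hξ
  -- Kobayashi's `L_p^ε` out of the Pollack pair
  set L := kobayashiL ε Lplus Lminus with hL_def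
  have hL : IsSignedPAdicLFunction f p ε L := hPP.isSignedPAdicLFunction_kobayashiL ε
  -- (MC↑), integral: `ξ ∣ L` under `p`-adic surjectivity (from mod-`p` surjectivity)
  have hsurj : ∀ m : ℕ, W.HasSurjectiveModNGaloisRep (p ^ m : ℕ) :=
    surjective_pow_of_surj_of_good W p hL20 hp hgood hs
  have hU : ξ ∣ L := h41.dvd_of_charIdeal_eq_span hp hgood hap hf hκ hγ hγ' hL D hX hsurj hξ'
  -- (C): `T^{rank E(ℚ)} ∣ ξ`, and `rank E(ℚ) = 1` by GZK
  have hC := D.X_pow_mordellWeilRank_dvd_of_charIdeal_eq_span hγ hX hξ'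
  have hrank : W.mordellWeilRank = 1 := (hGZK W (by omega)).1.trans h1
  rw [hrank, pow_one] at hC
  -- the certificate and the squeeze: `(ξ) = (L)`
  obtain ⟨hμ, hlam⟩ := hcert f hf L hL
  have hspan : Ideal.span ({ξ} : Set (IwasawaAlgebra p)) = Ideal.span {L} :=
    span_eq_span_of_dvd_of_X_dvd_of_lam_eq_one hU hC hμ hlam
  -- the period ratio `ϖ` is a `p`-adic unit (`E[p]` irreducible at a supersingular odd `p`)
  have hirr : W.HasIrreducibleModPGaloisRep p :=
    hasIrreducibleModPGaloisRep_of_dvd_frobeniusTrace W p hp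
      (W.not_dvd_minimalDiscriminantInt_of_hasGoodReductionAtPrime' p hgood) (by rw [hap]; exact dvd_zero _)
  have hvϖ : padicValRat p ϖ = 0 := padicValRat_periodRatio_eq_zero h5 h3 W p hp hgood hirr f hf ϖ hϖ
  have hϖ0 : ϖ ≠ 0 := by
    intro h0
    rw [h0, Rat.cast_zero, zero_mul] at hϖ
    exact (IsNewform0.plusPeriod_pos_holds hf.1 hf.coeffField_eq_bot).ne' hϖ.symm
  obtain ⟨u, hu⟩ := exists_units_coe_eq_ratCast hϖ0 hvϖ
  obtain ⟨hspan', hι⟩ := span_C_units_mul_eq u L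
  refine ⟨PowerSeries.C (u : ℤ_[p]) * L, ?_, ?_⟩
  · rw [hξ', hspan, hspan']
  · rw [hι, hu]

/-- **X7 ∧ `r_an = 1` ∧ surj(p) ∧ `a_p = 0`: Kobayashi's main conjecture for `(E, p, ε)` at the pair
from the certificate `(μ, λ)(L_p^ε) = (0, 1)`.** On class X7 (good supersingular at `p`, `E` not
semistable), odd `p`: good reduction is part of the class; `a_p = 0` is automatic for `p ≥ 5`
(`ClassX7.frobeniusTrace_eq_zero_of_five_le`) and a hypothesis at `p = 3` (the `a_3 = ±3` pairs are
class X8, ♯/♭); `surj` displayed (71 of the 72 rank-one X7 census pairs). Census (gen 2 / harvest-1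
g19): 31 of 72 X7 rank-one pairs `N < 2·10⁴` carry the certificate for some `ε`. PER PAIR; what then
separates the pair from `BSD(E,p)` is the rank-one link of Kobayashi 2013 (unread, not typed).
[cite: Kobayashi2003, Thm. 1.2, Thm. 4.1 and Conjecture (p. 2)] [cite: GreenbergVatsal2000, p. 4 and §3 Remark 3.4]
[cite: Wuthrich2014, Lemma 20 (p. 399)] -/
theorem X7.kobayashiMainConjecture_of_lam_eq_one_of_analyticRank_eq_one
    (h12 : Kobayashi2003.thm12_signedSelmerDual_finite_torsion)
    (h41 : Kobayashi2003.thm41_signedCharIdeal_divisibility)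
    (h5 : realPeriodRat_eq_unit_mul_plusPeriod) (h3 : realPeriodRat_eq_unit_mul_plusPeriod_three)
    (hL20 : Wuthrich2014.lemma20_surjective_threeAdic_of_semistable)
    (hGZK : rank_eq_analyticRank_of_analyticRank_le_one)
    (hp : p ≠ 2) (hX : ClassX7 W p) (hap : W.frobeniusTrace p = 0) (hs : Surj W p)
    (h1 : W.analyticRank = 1) (ε : ℤˣ)
    (hcert : ∀ {N : ℕ} [NeZero N] (f : CuspForm (Gamma0 N) 2), IsNewformOf W f →
      ∀ L : IwasawaAlgebra p, IsSignedPAdicLFunction f p ε L → mu L = 0 ∧ lam L = 1) :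
    KobayashiMainConjecture W p ε :=
  _root_.Summit.BirchSwinnertonDyer.Rank1Residual.Supersingular.kobayashiMainConjecture_of_lam_eq_one_of_analyticRank_eq_one
    W p h12 h41 h5 h3 hL20 hGZK hp hX.1.1 hap hs h1 ε hcert

/-- **X6 ∧ `r_an = 1`: Kobayashi's main conjecture for `(E, p, ε)` at the pair from the certificate
`(μ, λ)(L_p^ε) = (0, 1)`**, with `a_p = 0` (`ClassX6.frobeniusTrace_eq_zero`) and surjectivity of
`ρ̄_{E,p}` (`ClassX6.surj`: semistable + irreducible, Serre Prop. 21) AUTOMATIC on class X6 at an odd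
prime. (X6 ∩ {r_an = 1} is not residual in the census — JSW 2017 Thm. 1.2.1 with flag `JSW-ss`, or
Sprung 2024 Cor. 1.3 (ii) + unit `#Ш_an` —; recorded because the signed main conjecture at the pair
is a statement of independent standing.) PER PAIR. [cite: Kobayashi2003, Thm. 1.2, Thm. 4.1 and Conjecture (p. 2)]
[cite: Serre1972, §5.4 Prop. 21 i)] [cite: GreenbergVatsal2000, p. 4 and §3 Remark 3.4] -/
theorem X6.kobayashiMainConjecture_of_lam_eq_one_of_analyticRank_eq_one
    (h12 : Kobayashi2003.thm12_signedSelmerDual_finite_torsion)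
    (h41 : Kobayashi2003.thm41_signedCharIdeal_divisibility)
    (h5 : realPeriodRat_eq_unit_mul_plusPeriod) (h3 : realPeriodRat_eq_unit_mul_plusPeriod_three)
    (hL20 : Wuthrich2014.lemma20_surjective_threeAdic_of_semistable)
    (hGZK : rank_eq_analyticRank_of_analyticRank_le_one)
    (hp : p ≠ 2) (hX : ClassX6 W p) (h1 : W.analyticRank = 1) (ε : ℤˣ)
    (hcert : ∀ {N : ℕ} [NeZero N] (f : CuspForm (Gamma0 N) 2), IsNewformOf W f →
      ∀ L : IwasawaAlgebra p, IsSignedPAdicLFunction f p ε L → mu L = 0 ∧ lam L = 1) :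
    KobayashiMainConjecture W p ε :=
  _root_.Summit.BirchSwinnertonDyer.Rank1Residual.Supersingular.kobayashiMainConjecture_of_lam_eq_one_of_analyticRank_eq_one
    W p h12 h41 h5 h3 hL20 hGZK hp hX.1.1 (ClassX6.frobeniusTrace_eq_zero W p hp hX) (ClassX6.surj W p hp hX)
    h1 ε hcert

end Squeeze

end Summit.BirchSwinnertonDyer.Rank1Residual.Supersingular

end
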